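import Summits.AtomisticToContinuum.HydrodynamicLimit.Theses.AnnealedZeroHorizon
import Summits.AtomisticToContinuum.HydrodynamicLimit.Theorems.AnnealedZeroHorizonMeanSecondLawWildWeight
import Summits.AtomisticToContinuum.HydrodynamicLimit.Theorems.AnnealedZeroHorizonMeanSecondLawEntropyFloor
import Summits.AtomisticToContinuum.HydrodynamicLimit.Theorems.AnnealedZeroHorizonMeanSecondLawMeanKineticEnergy
import Summits.AtomisticToContinuum.HydrodynamicLimit.Theorems.LocalSecondLaw.Negative.HomogeneousLLN
import Summits.AtomisticToContinuum.HydrodynamicLimit.Theorems.LocalSecondLaw.Negative.FreeVolume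
import Summits.AtomisticToContinuum.HydrodynamicLimit.Theorems.LocalSecondLaw.Negative.Functional
import Summits.AtomisticToContinuum.HydrodynamicLimit.Theorems.AprioriBounds.Negative.AdmissibleKernel
import Literature.MathematicalPhysics.KineticTheory.HardSphereUniformGas
import Literature.Analysis.FluidPDE.HardSphereAlexander
import Literature.Analysis.FunctionSpaces.TorusMollifier
import HarnessLib

/-!
# Refutation of `AnnealedZeroHorizon.MeanSecondLaw` (crux stmt-AtomisticToContinuum-9257)

The crux quantifies the comparison triple `(ρ₁, u₁, θ₁)` universally, tied to the data only through
`TendstoHydroFieldsAt … (ρ₁) (u₁) (θ₁) 0`.  That hypothesis sees `u₁` only through the Bochner integrals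
`∫ (χ·ρ₁) • u₁` (junk value `0` when the integrand is not integrable) and `θ₁` only through the energy
density `ρ₁(|u₁|²/2 + 3θ₁/2)`.  For the homogeneous data `(a₀, θ₀, u₀) = (1, 1, 0)` the triple
`(1, λ g e, 1 − λ²g²/3)` — `g ≥ 1` measurable, NOWHERE locally integrable, `log g ∈ L¹`, `e` a unit
vector, `λ = e⁴` — satisfies the hypothesis verbatim (it is the tree's identified law of large numbers
`LocalSecondLawNegative.homogeneous_lln_identified`), while the crux's right-hand side
`∫ −(3/2) log|1 − λ²g²/3| dx + f_ex(σ³) ≤ −3 log λ + 5 = −7`; the left-hand side obeys the pointwise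
floor `S_N(z) ≥ −1 − (N+1)⁻¹ Σᵢ |vᵢ|²/2` (`f_ex ≥ 0`, `x log x ≥ −1`, `log Θ ≤ Θ − 1`, Cauchy–Schwarz;
Bochner junk only lifts `S` to `0`), so `E[S_N] ≥ −5/2` whenever `S_N` is integrable.  At `t = 0`,
`ε = 1`, the standard torus mollifier as kernel and the first eventual `N` this contradicts the
conclusion `Integrable S_N ∧ E[S_N] ≤ RHS + ε`.

Lead prover `prover-line-stmt-AtomisticToContinuum-9257-c2-0`, 2026-08-17.
-/

namespace Summit.AtomisticToContinuum.HydrodynamicLimit.Theses.AnnealedZeroHorizon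
/-- **Record of the dropped route item `MeanSecondLaw`** = stmt-AtomisticToContinuum-9257 (ledger signature verbatim; NOT a route
item): route AnnealedZeroHorizon (2026-08-17T10:20Z) dropped the refuted `MeanSecondLaw`. The declaration `Summit.AtomisticToContinuum.HydrodynamicLimit.Theses.AnnealedZeroHorizon.MeanSecondLaw`
therefore no longer exists in the route file and this accepted module stopped elaborating (stale olean;
buildfix lane 2026-08-19). Re-created here under its original name so the result keeps building; the
statement of every previously accepted declaration in this file is unchanged. -/
def MeanSecondLaw : Prop :=
  ∀ (a₀ θ₀ : Literature.MathematicalPhysics.KineticTheory.T3 → ℝ) (u₀ : Literature.MathematicalPhysics.KineticTheory.T3 → Literature.MathematicalPhysics.KineticTheory.V3), Continuous a₀ → Continuous θ₀ → Continuous u₀ → (∀ x, 0 < a₀ x) → (∀ x, 0 < θ₀ x) → ∃ σ₀ : ℝ, 0 < σ₀ ∧ ∀ σ : ℝ, 0 < σ → σ < σ₀ → ∀ Φ : (N : ℕ) → Literature.Analysis.FluidPDE.HardSphereFlow (Literature.Analysis.FluidPDE.Torus.geometry (Fin 3)) (Literature.MathematicalPhysics.KineticTheory.hsDiameter σ N)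 (N + 1), ∀ (ρ₁ θ₁ : Literature.MathematicalPhysics.KineticTheory.T3 → ℝ) (u₁ : Literature.MathematicalPhysics.KineticTheory.T3 → Literature.MathematicalPhysics.KineticTheory.V3), Literature.MathematicalPhysics.KineticTheory.TendstoHydroFieldsAt (fun N => Literature.MathematicalPhysics.KineticTheory.localGibbsLaw σ a₀ u₀ θ₀ N (Φ N)) Φ (fun _ => ρ₁) (fun _ => u₁) (fun _ => θ₁) 0 → ∀ t : ℝ, 0 ≤ t → ∀ ε : ℝ, 0 < ε → ∃ ℓ : ℝ, 0 < ℓ ∧ ∀ k : Literature.MathematicalPhysics.KineticTheory.T3 → ℝ, (Continuous k ∧ (∀ y, 0 ≤ k y) ∧ (∫ y, k y = 1) ∧ (∀ y, k y ≠ 0 → Literature.Analysis.FluidPDE.Torus.euclidDist y 0 < ℓ)) → ∀ᶠ N in Filter.atTop, let S : Literature.Analysis.FluidPDE.Config (N + 1) (Fin 3) Literature.MathematicalPhysics.KineticTheory.T3 → ℝ := fun z => ∫ x, (let R : ℝ := Literature.MathematicalPhysics.KineticTheory.empiricalDensityField ((Φ N).flow t z) (fun y => k (x - y)); let Mv : Literature.MathematicalPhysics.KineticTheory.V3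 := Literature.MathematicalPhysics.KineticTheory.empiricalMomentumField ((Φ N).flow t z) (fun y => k (x - y)); let En : ℝ := Literature.MathematicalPhysics.KineticTheory.empiricalEnergyField ((Φ N).flow t z) (fun y => k (x - y)); let Θ : ℝ := 2 / 3 * (En / R - ‖Mv‖ ^ 2 / (2 * R ^ 2)); -(R * (3 / 2 * Real.log Θ - Real.log R - Literature.MathematicalPhysics.KineticTheory.hsExcessFreeEnergy (R * σ ^ 3)))); MeasureTheory.Integrable S (Literature.MathematicalPhysics.KineticTheory.localGibbsLaw σ a₀ u₀ θ₀ N (Φ N)) ∧ ∫ z, S z ∂Literature.MathematicalPhysics.KineticTheory.localGibbsLaw σ a₀ u₀ θ₀ N (Φ N) ≤ (∫ x, -((ρ₁ x) * (3 / 2 * Real.log (2 / 3 * ((Literature.MathematicalPhysics.KineticTheory.totalEnergyDensity (ρ₁ x) (u₁ x) (θ₁ x)) / (ρ₁ x) - ‖(ρ₁ x) • u₁ x‖ ^ 2 / (2 * (ρ₁ x) ^ 2))) - Real.log (ρ₁ x) - Literature.MathematicalPhysics.KineticTheory.hsExcessFreeEnergy ((ρ₁ x) * σ ^ 3)))) +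 ε
end Summit.AtomisticToContinuum.HydrodynamicLimit.Theses.AnnealedZeroHorizon


noncomputable section

namespace Summit.AtomisticToContinuum.HydrodynamicLimit.Theorems

open MeasureTheory Filter Set Topology
open scoped ENNReal
open Literature.MathematicalPhysics.KineticTheory Literature.Analysis.FluidPDE

namespace MeanSecondLawRefutation

open LocalSecondLawNegative (ke hsExcessFreeEnergy_nonneg mul_log_ge_neg_one hsExcessFreeEnergy_le_two
  homogeneous_lln_identified)

/-! The three analytic inputs live in their own files (landed as supports of the crux item):
`exists_wildWeight` (a nowhere locally integrable weight with integrable logarithm, p147382),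
`entropyFloor` (the pointwise floor `S ≥ −1 − ke` of the coarse-grained entropy, p149602) and
`meanKineticEnergy_homogeneous` (`E[ke] = 3θ/2` under the homogeneous local Gibbs law, p150600). -/

/-! ## P3 — an admissible kernel at every radius -/

/-- For every `ℓ > 0` there is an admissible coarse-graining kernel: continuous, `≥ 0`, unit mass,
vanishing outside the minimal-image ball of radius `ℓ` (the torus mollifier `Torus.kernel ε`,
`ε = min(ℓ/8, 1/4)`, and `euclidDist y 0 ≤ 4‖y‖`). [folklore] -/
theorem exists_admissibleKernel {ℓ : ℝ} (hℓ : 0 < ℓ) :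
    ∃ k : T3 → ℝ, Continuous k ∧ (∀ y, 0 ≤ k y) ∧ (∫ y, k y = 1) ∧
      (∀ y, k y ≠ 0 → Torus.euclidDist y 0 < ℓ) := by
  set ε : ℝ := min (ℓ / 8) (1 / 4) with hε
  have hε0 : 0 < ε := lt_min (by positivity) (by norm_num)
  have hε4 : ε ≤ 1 / 4 := min_le_right _ _
  have hεℓ : ε ≤ ℓ / 8 := min_le_left _ _
  refine ⟨Literature.Analysis.FunctionSpaces.Torus.kernel ε,
    Literature.Analysis.FunctionSpaces.Torus.continuous_kernel hε0 hε4,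
    Literature.Analysis.FunctionSpaces.Torus.kernel_nonneg hε0.le,
    Literature.Analysis.FunctionSpaces.Torus.integral_kernel hε0 hε4, fun y hy => ?_⟩
  have hlt : ‖y‖ < ε := by
    by_contra h
    exact hy (Literature.Analysis.FunctionSpaces.Torus.kernel_eq_zero_of_le hε0 (not_lt.1 h))
  calc Torus.euclidDist y 0 ≤ 4 * ‖y‖ := AprioriBoundsNegative.euclidDist_zero_le_four_mul_norm y
    _ < 4 * ε := by linarith
    _ ≤ ℓ / 2 := by linarith
    _ < ℓ := by linarith

/-! ## P2 — the momentum test integrals of a wild field are junk `0` -/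

/-- If `g` is integrable on no nonempty open set, `lam ≠ 0`, `e ≠ 0` and `χ` is continuous, then
`x ↦ (χ x · 1) • ((lam · g x) • e)` is either identically `0` (`χ ≡ 0`) or not integrable; in both
cases its Bochner integral is `0`. [folklore] -/
theorem integral_test_smul_wild_eq_zero {g : T3 → ℝ} (hg0 : ∀ x, 0 ≤ g x)
    (hgU : ∀ U : Set T3, IsOpen U → U.Nonempty → ¬ IntegrableOn g U) {lam : ℝ} (hlam : lam ≠ 0)
    {e : V3} (he : e ≠ 0) {χ : T3 → ℝ} (hχ : Continuous χ) :
    ∫ x, (χ x * (1 : ℝ)) • ((lam * g x) • e) = 0 := by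
  by_cases hz : ∀ x, χ x = 0
  · simp [hz]
  push Not at hz
  obtain ⟨x₀, hx₀⟩ := hz
  refine integral_undef fun hint => ?_
  -- a ball around `x₀` on which `|χ| ≥ |χ x₀| / 2`
  have hpos0 : 0 < |χ x₀| := abs_pos.2 hx₀
  have hc : 0 < |χ x₀| / 2 := by positivity
  obtain ⟨r, hr, hball⟩ : ∃ r > 0, ∀ x, dist x x₀ < r → |χ x₀| / 2 ≤ |χ x| := by
    have hcont : ContinuousAt (fun x => |χ x|) x₀ := (continuous_abs.comp hχ).continuousAt
    have hev : ∀ᶠ x in 𝓝 x₀, |χ x₀| / 2 < |χ x| :=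
      hcont.eventually (lt_mem_nhds (show |χ x₀| / 2 < |χ x₀| by linarith))
    obtain ⟨r, hr, h⟩ := Metric.eventually_nhds_iff.1 hev
    exact ⟨r, hr, fun x hx => (h hx).le⟩
  set U : Set T3 := Metric.ball x₀ r with hU
  have hUo : IsOpen U := Metric.isOpen_ball
  have hUn : U.Nonempty := ⟨x₀, Metric.mem_ball_self hr⟩
  refine hgU U hUo hUn ?_
  -- on `U`, `g ≤ C ‖integrand‖`
  have hne : 0 < |lam| * ‖e‖ := mul_pos (abs_pos.2 hlam) (norm_pos_iff.2 he)
  set C : ℝ := (|χ x₀| / 2 * (|lam| * ‖e‖))⁻¹ with hC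
  have hC0 : 0 ≤ C := by positivity
  have hnorm : ∀ x, ‖(χ x * (1 : ℝ)) • ((lam * g x) • e)‖ = |χ x| * (|lam| * ‖e‖) * g x := by
    intro x
    simp only [_root_.norm_smul, Real.norm_eq_abs, abs_mul, mul_one, abs_of_nonneg (hg0 x)]
    ring
  have hbound : ∀ x ∈ U, ‖g x‖ ≤ C * ‖(χ x * (1 : ℝ)) • ((lam * g x) • e)‖ := by
    intro x hx
    rw [hnorm, Real.norm_eq_abs, abs_of_nonneg (hg0 x), hC]
    have hχx : |χ x₀| / 2 ≤ |χ x| := hball x (Metric.mem_ball.1 hx)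
    have hgx := hg0 x
    have hkey : |χ x₀| / 2 * (|lam| * ‖e‖) * g x ≤ |χ x| * (|lam| * ‖e‖) * g x := by gcongr
    calc g x = (|χ x₀| / 2 * (|lam| * ‖e‖))⁻¹ * (|χ x₀| / 2 * (|lam| * ‖e‖) * g x) := by
          field_simp
      _ ≤ (|χ x₀| / 2 * (|lam| * ‖e‖))⁻¹ * (|χ x| * (|lam| * ‖e‖) * g x) :=
          mul_le_mul_of_nonneg_left hkey (by positivity)
  have hgm : AEStronglyMeasurable g (volume.restrict U) := by
    -- `g = C' • ‖integrand‖ / |χ|`-type identities are awkward; use a.e.-measurability of the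
    -- integrand and the algebraic identity `g = ‖integrand‖ / (|χ| |lam| ‖e‖)` on `U`
    have h1 : AEMeasurable (fun x => ‖(χ x * (1 : ℝ)) • ((lam * g x) • e)‖ / (|χ x| * (|lam| * ‖e‖)))
        (volume.restrict U) :=
      hint.aestronglyMeasurable.aemeasurable.norm.restrict.div
        ((continuous_abs.comp hχ).mul continuous_const).measurable.aemeasurable
    refine h1.aestronglyMeasurable.congr ?_
    filter_upwards [ae_restrict_mem hUo.measurableSet] with x hx
    rw [hnorm]
    have hχx : 0 < |χ x| := hc.trans_le (hball x (Metric.mem_ball.1 hx))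
    field_simp
  exact Integrable.mono' ((hint.norm.restrict (s := U)).const_mul C) hgm
    ((ae_restrict_mem hUo.measurableSet).mono fun x hx => hbound x hx)

/-! ## P7 — the wild triple satisfies the `t = 0` law of large numbers verbatim -/

/-- The energy density of the wild triple is that of the homogeneous state: `E(1, u, 1 − |u|²/3) = 3/2`.
[folklore] -/
theorem totalEnergyDensity_wild (u : V3) :
    totalEnergyDensity 1 u (1 - ‖u‖ ^ 2 / 3) = totalEnergyDensity 1 0 1 := by
  simp only [totalEnergyDensity, norm_zero]
  ring

/-- **LLN transfer.** If the local Gibbs fields of the homogeneous data `(1, 1, 0)` converge at `t = 0`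
to `(1, 0, 1)`, they also "converge" to the wild triple `(1, λ g e, 1 − λ²g²/3)`: the three families
of deviation events coincide (density untouched; momentum test integrals junk `0` on both sides;
energy densities equal pointwise). [folklore] -/
theorem tendstoHydroFieldsAt_wild {σ : ℝ}
    {Φ : (N : ℕ) → HardSphereFlow (Torus.geometry (Fin 3)) (hsDiameter σ N) (N + 1)}
    (h : TendstoHydroFieldsAt (fun N => localGibbsLaw σ (fun _ => 1) (fun _ => 0) (fun _ => 1) N (Φ N)) Φ
      (fun _ _ => (1 : ℝ)) (fun _ _ => (0 : V3)) (fun _ _ => (1 : ℝ)) 0)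
    {g : T3 → ℝ} (hg0 : ∀ x, 0 ≤ g x)
    (hgU : ∀ U : Set T3, IsOpen U → U.Nonempty → ¬ IntegrableOn g U) {lam : ℝ} (hlam : lam ≠ 0)
    {e : V3} (he : e ≠ 0) :
    TendstoHydroFieldsAt (fun N => localGibbsLaw σ (fun _ => 1) (fun _ => 0) (fun _ => 1) N (Φ N)) Φ
      (fun _ _ => (1 : ℝ)) (fun _ x => (lam * g x) • e) (fun _ x => 1 - ‖(lam * g x) • e‖ ^ 2 / 3) 0 := by
  intro χ hχ δ hδ
  obtain ⟨h1, h2, h3⟩ := h χ hχ δ hδ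
  refine ⟨h1, ?_, ?_⟩
  · have hI : ∫ x, (χ x * (1 : ℝ)) • ((lam * g x) • e) = ∫ x, (χ x * (1 : ℝ)) • (0 : V3) := by
      rw [integral_test_smul_wild_eq_zero hg0 hgU hlam he hχ]
      simp
    simpa only [hI] using h2
  · have hE : (fun x => χ x * totalEnergyDensity 1 ((lam * g x) • e) (1 - ‖(lam * g x) • e‖ ^ 2 / 3)) =
        fun x => χ x * totalEnergyDensity 1 0 1 := by
      funext x; rw [totalEnergyDensity_wild]
    simpa only [hE] using h3

/-! ## P6 — the right-hand side of the crux at the wild triple -/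

/-- Pointwise form of the crux's comparison integrand at the wild triple: for `‖e‖ = 1`, `3 ≤ λ`,
`1 ≤ g x` it equals `−(3/2) log(λ²g²/3 − 1) + f_ex(σ³)` and is `≤ −3 log λ + (3/2) log 6 + f_ex(σ³)`,
`≥ −3 log λ − 3 log (g x) + f_ex(σ³)`. [folklore] -/
theorem rhsIntegrand_eq {σ lam : ℝ} {e : V3} (he : ‖e‖ = 1) (x : ℝ) :
    -((1 : ℝ) * (3 / 2 * Real.log (2 / 3 * ((totalEnergyDensity 1 ((lam * x) • e)
        (1 - ‖(lam * x) • e‖ ^ 2 / 3)) / 1 - ‖(1 : ℝ) • ((lam * x) • e)‖ ^ 2 / (2 * (1 : ℝ) ^ 2))) -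
        Real.log 1 - hsExcessFreeEnergy (1 * σ ^ 3))) =
      -(3 / 2) * Real.log (1 - (lam * x) ^ 2 / 3) + hsExcessFreeEnergy (σ ^ 3) := by
  have hn : ‖(lam * x) • e‖ = |lam * x| := by rw [norm_smul, he, mul_one, Real.norm_eq_abs]
  simp only [totalEnergyDensity, one_smul, hn, sq_abs, Real.log_one, one_mul, div_one, one_pow,
    mul_one, sub_zero]
  ring_nf

/-- **Upper bound of the right-hand side at the wild triple**: for `0 ≤ σ ≤ 1/2`, `g ≥ 1` measurable with
`log g ∈ L¹`, `‖e‖ = 1` and `3 ≤ λ`, the crux's comparison functional is `≤ −3 log λ + 5`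
(`log(λ²g²/3 − 1) ≥ 2 log λ − log 6`, `(3/2) log 6 ≤ 3`, `f_ex(σ³) ≤ 2`; the integrand is integrable
because `log g` is). [folklore] -/
theorem rhs_le {σ : ℝ} (hσ0 : 0 ≤ σ) (hσ : σ ≤ 1 / 2) {g : T3 → ℝ} (hgm : Measurable g)
    (hg1 : ∀ x, 1 ≤ g x) (hglog : Integrable (fun x => Real.log (g x))) {lam : ℝ} (hlam : 3 ≤ lam)
    {e : V3} (he : ‖e‖ = 1) :
    ∫ x, -((1 : ℝ) * (3 / 2 * Real.log (2 / 3 * ((totalEnergyDensity 1 ((lam * g x) • e)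
        (1 - ‖(lam * g x) • e‖ ^ 2 / 3)) / 1 - ‖(1 : ℝ) • ((lam * g x) • e)‖ ^ 2 / (2 * (1 : ℝ) ^ 2))) -
        Real.log 1 - hsExcessFreeEnergy (1 * σ ^ 3))) ≤ -3 * Real.log lam + 5 := by
  simp_rw [rhsIntegrand_eq he]
  have hf2 : hsExcessFreeEnergy (σ ^ 3) ≤ 2 := hsExcessFreeEnergy_le_two hσ0 hσ
  have hlam0 : 0 < lam := by linarith
  have hlog6 : Real.log 6 ≤ 2 := by
    rw [Real.log_le_iff_le_exp (by norm_num)]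
    have h1 := Real.exp_one_gt_d9
    have h2 : Real.exp 2 = Real.exp 1 * Real.exp 1 := by rw [← Real.exp_add]; norm_num
    nlinarith
  -- pointwise bounds on `L x := log ((λ g x)² / 3 − 1) = log (1 − (λ g x)²/3)`
  have hsq : ∀ x, 9 ≤ (lam * g x) ^ 2 := fun x => by
    have : 3 ≤ lam * g x := by nlinarith [hg1 x]
    nlinarith
  have hpos : ∀ x, 0 < (lam * g x) ^ 2 / 3 - 1 := fun x => by linarith [hsq x]
  have hLeq : ∀ x, Real.log (1 - (lam * g x) ^ 2 / 3) = Real.log ((lam * g x) ^ 2 / 3 - 1) := fun x => by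
    rw [← Real.log_abs, show |1 - (lam * g x) ^ 2 / 3| = (lam * g x) ^ 2 / 3 - 1 from by
      rw [abs_sub_comm]; exact abs_of_pos (hpos x)]
  have hLlow : ∀ x, 2 * Real.log lam - Real.log 6 ≤ Real.log ((lam * g x) ^ 2 / 3 - 1) := fun x => by
    have h6 : (lam * g x) ^ 2 / 6 ≤ (lam * g x) ^ 2 / 3 - 1 := by linarith [hsq x]
    have hg0 : 0 < g x := by linarith [hg1 x]
    calc 2 * Real.log lam - Real.log 6 ≤ 2 * Real.log lam + 2 * Real.log (g x) - Real.log 6 := by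
          linarith [Real.log_nonneg (hg1 x)]
      _ = Real.log ((lam * g x) ^ 2 / 6) := by
          rw [Real.log_div (by positivity) (by norm_num), Real.log_pow, Real.log_mul hlam0.ne' hg0.ne']
          push_cast; ring
      _ ≤ Real.log ((lam * g x) ^ 2 / 3 - 1) := Real.log_le_log (by positivity) h6
  have hLup : ∀ x, Real.log ((lam * g x) ^ 2 / 3 - 1) ≤ 2 * Real.log lam + 2 * Real.log (g x) := fun x => by
    have hg0 : 0 < g x := by linarith [hg1 x]
    calc Real.log ((lam * g x) ^ 2 / 3 - 1) ≤ Real.log ((lam * g x) ^ 2) :=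
          Real.log_le_log (hpos x) (by nlinarith [hsq x])
      _ = 2 * Real.log lam + 2 * Real.log (g x) := by
          rw [Real.log_pow, Real.log_mul hlam0.ne' hg0.ne']; push_cast; ring
  -- integrability of the integrand
  have hmeas : Measurable fun x => -(3 / 2) * Real.log (1 - (lam * g x) ^ 2 / 3) + hsExcessFreeEnergy (σ ^ 3) := by
    fun_prop
  have hint : Integrable fun x => -(3 / 2) * Real.log (1 - (lam * g x) ^ 2 / 3) + hsExcessFreeEnergy (σ ^ 3) := by
    have hB : Integrable (fun x => 3 * Real.log (g x) + (3 * |Real.log lam| + |hsExcessFreeEnergy (σ ^ 3)|)) :=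
      (hglog.const_mul 3).add (integrable_const _)
    refine hB.mono' hmeas.aestronglyMeasurable (ae_of_all _ fun x => ?_)
    rw [Real.norm_eq_abs, hLeq x]
    have h2 := hLup x
    have h3 : 0 ≤ Real.log (g x) := Real.log_nonneg (hg1 x)
    have h4 : 0 ≤ Real.log ((lam * g x) ^ 2 / 3 - 1) := Real.log_nonneg (by linarith [hsq x])
    have h5 : Real.log lam ≤ |Real.log lam| := le_abs_self _
    have h6 := le_abs_self (hsExcessFreeEnergy (σ ^ 3))
    have h7 := neg_abs_le (hsExcessFreeEnergy (σ ^ 3))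
    rw [abs_le]
    constructor <;> nlinarith
  -- compare with the constant
  have hmono : ∫ x, (-(3 / 2) * Real.log (1 - (lam * g x) ^ 2 / 3) + hsExcessFreeEnergy (σ ^ 3)) ≤
      ∫ _x : T3, (-3 * Real.log lam + 5 : ℝ) := by
    refine integral_mono hint (integrable_const _) fun x => ?_
    dsimp only
    rw [hLeq x]
    linarith [hLlow x]
  refine hmono.trans ?_
  rw [integral_const, smul_eq_mul, probReal_univ, one_mul]

end MeanSecondLawRefutation

/-! ## P8 — assembly -/

open MeanSecondLawRefutation LocalSecondLawNegative in
/-- **`MeanSecondLaw` is false as typed.**  Witness: data `(a₀, θ₀, u₀) = (1, 1, 0)`; for the `σ₀` the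
crux provides, `σ = min(σ₀, σ₁)/2` with `σ₁` the threshold of the identified homogeneous LLN; flows by
Alexander's theorem; comparison triple `(1, λ g e, 1 − λ²g²/3)` with `g` the wild weight of
`exists_wildWeight`, `e` a unit vector, `λ = e⁴`; `t = 0`, `ε = 1`, the torus mollifier as kernel, and the
first `N` of the eventual set.  Then `E[S_N] ≥ −1 − 3/2` (entropy floor + mean kinetic energy, `Φ₀ = id`
a.s.) while `RHS + 1 ≤ −3·4 + 5 + 1 = −6`. -/
theorem not_MeanSecondLaw :
    ¬ Summit.AtomisticToContinuum.HydrodynamicLimit.Theses.AnnealedZeroHorizon.MeanSecondLaw := by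
  intro H
  obtain ⟨σ₀, hσ₀, H1⟩ := H (fun _ => 1) (fun _ => 1) (fun _ => 0) continuous_const continuous_const
    continuous_const (fun _ => one_pos) (fun _ => one_pos)
  obtain ⟨σ₁, hσ₁, hσ₁2, HL⟩ := homogeneous_lln_identified one_pos
  set σ : ℝ := min σ₀ σ₁ / 2 with hσdef
  have hmin : 0 < min σ₀ σ₁ := lt_min hσ₀ hσ₁
  have hσ : 0 < σ := by positivity
  have hσσ₀ : σ < σ₀ := by
    have := min_le_left σ₀ σ₁; rw [hσdef]; linarith
  have hσσ₁ : σ < σ₁ := by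
    have := min_le_right σ₀ σ₁; rw [hσdef]; linarith
  have hσ2 : σ ≤ 1 / 2 := (hσσ₁.le.trans hσ₁2)
  have hσ2' : σ < 2⁻¹ := by
    rw [inv_eq_one_div]; exact hσσ₁.trans_le hσ₁2
  -- flows, by Alexander's theorem
  let Φ : (N : ℕ) → HardSphereFlow (Torus.geometry (Fin 3)) (hsDiameter σ N) (N + 1) := fun N =>
    Classical.choice (HardSphereFlow.nonempty_torus_holds (d := Fin 3) (hsDiameter_pos hσ N)
      ((hsDiameter_le hσ.le N).trans_lt hσ2') (N + 1))
  have hLLN := HL σ hσ hσσ₁ Φ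
  -- the wild comparison triple
  obtain ⟨g, hgm, hg1, hgU, hglog⟩ := exists_wildWeight
  have hg0 : ∀ x, 0 ≤ g x := fun x => zero_le_one.trans (hg1 x)
  set lam : ℝ := Real.exp 4 with hlam
  have hlam3 : 3 ≤ lam := by
    have := Real.add_one_le_exp (4 : ℝ); rw [hlam]; linarith
  have hlam0 : lam ≠ 0 := by positivity
  set e : V3 := EuclideanSpace.basisFun (Fin 3) ℝ 0 with hedef
  have he : ‖e‖ = 1 := (EuclideanSpace.basisFun (Fin 3) ℝ).orthonormal.1 0
  have he0 : e ≠ 0 := by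
    intro h0; rw [h0, norm_zero] at he; exact zero_ne_one he
  set u₁ : T3 → V3 := fun x => (lam * g x) • e with hu₁
  set θ₁ : T3 → ℝ := fun x => 1 - ‖(lam * g x) • e‖ ^ 2 / 3 with hθ₁
  have hT : TendstoHydroFieldsAt (fun N => localGibbsLaw σ (fun _ => 1) (fun _ => 0) (fun _ => 1) N (Φ N)) Φ
      (fun _ => fun _ => (1 : ℝ)) (fun _ => u₁) (fun _ => θ₁) 0 :=
    tendstoHydroFieldsAt_wild hLLN hg0 hgU hlam0 he0
  -- the crux at `t = 0`, `ε = 1`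
  obtain ⟨ℓ, hℓ, H2⟩ := H1 σ hσ hσσ₀ Φ (fun _ => 1) θ₁ u₁ hT 0 le_rfl 1 one_pos
  obtain ⟨k, hkc, hk0, hk1, hkℓ⟩ := exists_admissibleKernel hℓ
  obtain ⟨N, hN⟩ := (H2 k ⟨hkc, hk0, hk1, hkℓ⟩).exists
  obtain ⟨hint, hle⟩ := hN
  set P := localGibbsLaw σ (fun _ => (1 : ℝ)) (fun _ => (0 : V3)) (fun _ => (1 : ℝ)) N (Φ N) with hP
  haveI : IsProbabilityMeasure P := isProbabilityMeasure_localGibbsLaw continuous_const continuous_const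
    continuous_const (fun _ => one_pos) (fun _ => one_pos) hσ2 N (Φ N)
  -- the right-hand side is `≤ -7`
  have hR := rhs_le hσ.le hσ2 hgm hg1 hglog hlam3 he (σ := σ)
  have hR7 : -3 * Real.log lam + 5 = -7 := by rw [hlam, Real.log_exp]; norm_num
  -- the left-hand side is `≥ -5/2`
  obtain ⟨hkeI, hkeE⟩ := meanKineticEnergy_homogeneous hσ2 one_pos N (Φ N)
  -- `Φ₀ = id` almost surely: the law is Liouville-absolutely continuous and `good` is conull
  have hac : P ≪ liouville (Torus.geometry (Fin 3)) (N + 1) (hsDiameter σ N) :=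
    withDensity_absolutelyContinuous _ _
  have hgood : ∀ᵐ z ∂P, z ∈ (Φ N).good := hac.ae_le (Φ N).ae_mem_good
  have hkeflow : (fun z => ke ((Φ N).flow 0 z)) =ᵐ[P] ke := by
    filter_upwards [hgood] with z hz
    rw [(Φ N).flow_zero z hz]
  have hkeI' : Integrable (fun z => -1 - ke ((Φ N).flow 0 z)) P :=
    (integrable_const _).sub (hkeI.congr hkeflow.symm)
  have hlow := integral_mono hkeI' hint fun z => entropyFloor σ hkc hk0 hk1 ((Φ N).flow 0 z)
  have hval : ∫ z, (-1 - ke ((Φ N).flow 0 z)) ∂P = -1 - 3 / 2 * 1 := by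
    rw [integral_sub (integrable_const _) (hkeI.congr hkeflow.symm), integral_const, smul_eq_mul,
      probReal_univ, one_mul, integral_congr_ae hkeflow, hkeE]
  rw [hval] at hlow
  have hfin := hlow.trans hle
  linarith

end Summit.AtomisticToContinuum.HydrodynamicLimit.Theorems

end
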